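import Summits.RiemannHypothesis.RiemannHypothesis.Theorems.Splittings.ZdReferencePinsFrame
import HarnessLib

/-!
# Reference pins REFUTED (N63): the local gap engine modulo the named fact `buiMilinovich2018_theorem11_critical` (zd-neg g9 §3)

Cell rh-split, seat rh-split-zd-neg g9 (brief sha16 f79c5f09d8bcb036), card `run/shared/lean/pub/rh-split/cards/SPLIT-zd-neg.md` GEN-9
(N62–N64, B10); source `HOME/rh-split-zd-neg/SketchG9r3.lean` sha16 baf56696ec23d90d §§0–6 (= `SketchG9.lean` 1de7f68b shifted), referee
rh-split-ref g4 REPLAY PASS 2026-08-27T07:55:17Z (rev.2) / 08:13:14Z (r3); lead rh-split-lead g3 lane (x-c), CARVE MAP in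
`HOME/rh-split-zd-neg/HANDOFF-g9.md`.  Filed by rh-split-typer-2 g4 as three files (`ZdReferencePinsFrame` §§0–2 → `ZdReferencePins` §3 →
`ZdReferencePinsExact` §§4–6), namespace `RhSplitZdNegG9` ↦ `…Splittings.ZdReferencePins`; deltas per the CARVE MAP conventions: the scratch
abbreviations `FIN` / `H₀` are SPELLED OUT (`riemannHypothesisUpTo_platt_trudgian` / `3000175332800`) and dropped, decl text otherwise byte-verbatim;
`RiemannHypothesis` is the summit's (`Summits.RiemannHypothesis.Statement`).

CONTENT (count side of the zd splitting search): «reference pins» — tails saying that the zero-counting jump `S(t) − S(t/2)` (or a windowed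
version) stays small above a height — are VALID splitting partners of FIN in the trivial direction (§2) but are REFUTED: §3 (N63) by the local gap
engine modulo the tree-NAMED fact `buiMilinovich2018_theorem11_critical` (hypothesis position), §4 (N64) the exact-ratio reference only extracts a
dyadic companion, §5–§6 shrinking windows/widths (B10 scope).  The UNCONDITIONAL refutation of every pin containing the half-height point is E2
(`ZdTwoHeightMeanSquare.lean`).  LABELS (referee g4): RH-FREE kernel bookkeeping / refutations; class (zd, neg) UNCHANGED = BARRIER NOTE, 0 survivors.

This file: §3: `abs_sub_lt_of_dyadicPinW`, `thetaDerivErr`, `theta_sub_ge`, `count_eq_of_rhAbove_of_gap`, `not_dyadicPinW_of_rhAbove`, `not_dyadicPinW`,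
`not_dyadicPin`, `n63_summary` — all modulo the tree-named fact in hypothesis position.

Gate dedup: `log_two_pi_le_two` is `private` here (it restates the landed `Literature.NumberTheory.LFunctions.LittlewoodAverage.log_two_pi_le_two`);
its one downstream use (in `ZdReferencePinsExact.lean`) cites the landed lemma.

HONEST LABEL: «SPLITTING SEARCH over kernel-typed RH-EQUIVALENCES; a splitting A ∧ B ⟹ RH is CONDITIONAL bookkeeping unless A and B are
both proved; nothing here bears on the truth of RH.»
-/

set_option linter.dupNamespace false

noncomputable section

open Filter Complex
open scoped Real Topology

namespace Summit.RiemannHypothesis.RiemannHypothesis.Theorems.Splittings.ZdReferencePins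

open Literature.NumberTheory.DiophantineGeometry Literature.NumberTheory.LFunctions
  Literature.Barriers.RiemannHypothesis

/-! ## §3 N63 is REFUTED: the local gap engine -/

/-- A constant-width pin couples any two heights at distance `≤ 2w₀` (common reference `t₂/2`):
`|S(t₁) − S(t₂)| < 2r`. -/
theorem abs_sub_lt_of_dyadicPinW {H r w₀ : ℝ} (h : DyadicPinW H r fun _ ↦ w₀) {t₁ t₂ : ℝ}
    (h₁ : H ≤ t₁) (h₁₂ : t₁ ≤ t₂) (h₂ : t₂ ≤ t₁ + 2 * w₀) :
    |zetaArgS t₁ - zetaArgS t₂| < 2 * r := by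
  have a := abs_lt.1 (h t₁ (t₂ / 2) h₁ (by linarith) (by linarith))
  have b := abs_lt.1 (h t₂ (t₂ / 2) (h₁.trans h₁₂) le_rfl (by linarith))
  exact abs_lt.2 ⟨by linarith [a.1, b.2], by linarith [a.2, b.1]⟩

/-- N63 instance: `|S(t₁) − S(t₂)| < 2` whenever `H ≤ t₁ ≤ t₂ ≤ t₁ + 2`. -/
theorem abs_sub_lt_two_of_dyadicPin {H : ℝ} (h : DyadicPin H) {t₁ t₂ : ℝ} (h₁ : H ≤ t₁)
    (h₁₂ : t₁ ≤ t₂) (h₂ : t₂ ≤ t₁ + 2) : |zetaArgS t₁ - zetaArgS t₂| < 2 := by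
  have := abs_sub_lt_of_dyadicPinW (r := 1) (w₀ := 1) h h₁ h₁₂ (by linarith)
  linarith [this]

/-- The error term of the explicit `θ'` floor (tree `riemannSiegelThetaDeriv_ge`). -/
def thetaDerivErr (a : ℝ) : ℝ := 1 / (4 * a ^ 2) + 2 / (3 * a ^ 3) + π / (6 * a ^ 2)

/-- `thetaDerivErr` is antitone. -/
theorem thetaDerivErr_anti {a x : ℝ} (ha : 0 < a) (hax : a ≤ x) :
    thetaDerivErr x ≤ thetaDerivErr a := by
  unfold thetaDerivErr
  have hx : 0 < x := ha.trans_le hax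
  gcongr

/-- `thetaDerivErr t ≤` its value at `10` for `t ≥ 10`. -/
theorem thetaDerivErr_le_of_ten_le {a : ℝ} (ha : 10 ≤ a) : thetaDerivErr a ≤ 1 / 100 := by
  refine (thetaDerivErr_anti (by norm_num : (0 : ℝ) < 10) ha).trans ?_
  unfold thetaDerivErr
  have hπ : π < 3.1416 := Real.pi_lt_d4
  norm_num
  linarith

/-- **Explicit `θ`-increment floor**: for `2 ≤ a ≤ b`,
`θ(b) − θ(a) ≥ (b − a)·(½ log(a/2π) − err(a))` (mean value theorem with the tree's `θ'` floor). -/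
theorem theta_sub_ge {a b : ℝ} (ha : 2 ≤ a) (hab : a ≤ b) :
    (Real.log (a / (2 * π)) / 2 - thetaDerivErr a) * (b - a) ≤
      riemannSiegelTheta b - riemannSiegelTheta a := by
  have ha0 : 0 < a := by linarith
  have hD : Convex ℝ (Set.Ici a) := convex_Ici a
  have hcont : ContinuousOn riemannSiegelTheta (Set.Ici a) :=
    continuous_riemannSiegelTheta.continuousOn
  have hdiff : DifferentiableOn ℝ riemannSiegelTheta (interior (Set.Ici a)) :=
    fun x _ ↦ (hasDerivAt_riemannSiegelTheta_holds x).differentiableAt.differentiableWithinAt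
  have hge : ∀ x ∈ interior (Set.Ici a),
      Real.log (a / (2 * π)) / 2 - thetaDerivErr a ≤ deriv riemannSiegelTheta x := by
    intro x hx
    rw [interior_Ici] at hx
    have hax : a ≤ x := le_of_lt hx
    rw [(hasDerivAt_riemannSiegelTheta_holds x).deriv]
    have hb := riemannSiegelThetaDeriv_ge (u := x) (ha.trans hax)
    have hlog : Real.log (a / (2 * π)) ≤ Real.log (x / (2 * π)) :=
      Real.log_le_log (by positivity) (by gcongr)
    have herr := thetaDerivErr_anti ha0 hax
    unfold thetaDerivErr at herr ⊢
    linarith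
  exact hD.mul_sub_le_image_sub_of_le_deriv hcont hdiff hge a Set.self_mem_Ici b
    (Set.mem_Ici.2 hab) hab

/-- Under RH above `H`, a stretch `(t, t')` (`t ≥ H`, `t > 0`) free of CRITICAL zeros is free of
zeros: `N` is constant on `[t, t')`. -/
theorem count_eq_of_rhAbove_of_gap {H t t' u : ℝ} (hRH : RHAbove H) (hHt : H ≤ t)
    (htu : t ≤ u) (hut : u < t')
    (hfree : ∀ v : ℝ, t < v → v < t' → riemannZeta (1 / 2 + v * Complex.I) ≠ 0) :
    (zetaZeroCount u : ℝ) = zetaZeroCount t := by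
  classical
  have hsum := zetaZeroCountRe_sub_eq_sum 0 htu
  have hnone : ∀ ρ ∈ (zetaZeroBox_finite 0 u).toFinset \ (zetaZeroBox_finite 0 t).toFinset,
      False := by
    intro ρ hρ
    obtain ⟨hz, -, -, h3, h4⟩ := mem_sdiff_zetaZeroBox hρ
    have hre : ρ.re = 1 / 2 := hRH ρ hz (hHt.trans_lt h3)
    have hρeq : ρ = 1 / 2 + (ρ.im : ℂ) * Complex.I := by
      apply Complex.ext <;> simp [hre]
    have hz' : riemannZeta (1 / 2 + (ρ.im : ℂ) * Complex.I) = 0 := by rw [← hρeq]; exact hz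
    exact hfree ρ.im h3 (h4.trans_lt hut) hz'
  have hzero : ∑ ρ ∈ (zetaZeroBox_finite 0 u).toFinset \ (zetaZeroBox_finite 0 t).toFinset,
      (riemannZetaZeroOrder ρ : ℝ) = 0 :=
    Finset.sum_eq_zero fun ρ hρ ↦ (hnone ρ hρ).elim
  unfold zetaZeroCount
  have : ((zetaZeroCountRe 0 u : ℝ) - zetaZeroCountRe 0 t) = 0 := by rw [hsum, hzero]
  linarith

/-- `log (2π) ≤ 2`. -/
private theorem log_two_pi_le_two : Real.log (2 * π) ≤ 2 := by
  have hπ : π < 3.1416 := Real.pi_lt_d4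
  have he := Real.exp_one_gt_d9
  have h2 : Real.exp 2 = Real.exp 1 * Real.exp 1 := by rw [← Real.exp_add]; norm_num
  have h1 : 2 * π ≤ Real.exp 2 := by rw [h2]; nlinarith [Real.exp_pos (1 : ℝ)]
  calc Real.log (2 * π) ≤ Real.log (Real.exp 2) := Real.log_le_log (by positivity) h1
    _ = 2 := Real.log_exp 2

/-- **The local gap engine.** Under RH above `H`, every radius-1 constant-width (`w₀ > 0`, any size)
dyadic pin fails, modulo Bui–Milinovich 2018 Thm 1.1 (first clause, UNCONDITIONAL: consecutive
critical zeros `≥ 3.18` mean spacings apart above every height). -/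
theorem not_dyadicPinW_of_rhAbove (hBM : buiMilinovich2018_theorem11_critical) {H w₀ : ℝ}
    (hw₀ : 0 < w₀) (hRH : RHAbove H) : ¬ DyadicPinW H 1 fun _ ↦ w₀ := by
  intro hB
  obtain ⟨c', hc', hgap⟩ := hBM
  have hπ3 : 3 < π := Real.pi_gt_three
  have hπ4 : π < 3.15 := Real.pi_lt_d2
  -- threshold height `T₀ = max H (2π · exp (14 + 8 / w₀))`
  obtain ⟨t, t', hT₀t, htt', -, -, hfree, hc'le⟩ := hgap (max H (2 * π * Real.exp (14 + 8 / w₀)))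
  have hHt : H ≤ t := (le_max_left _ _).trans hT₀t
  have hAt : 2 * π * Real.exp (14 + 8 / w₀) ≤ t := (le_max_right _ _).trans hT₀t
  have h4w : 0 < 8 / w₀ := by positivity
  have hw0' : w₀ ≠ 0 := hw₀.ne'
  have hexp : 15 + 8 / w₀ ≤ Real.exp (14 + 8 / w₀) := by
    linarith [Real.add_one_le_exp (14 + 8 / w₀)]
  have hexp15 : (15 : ℝ) ≤ Real.exp (14 + 8 / w₀) := by linarith
  have h30 : 2 * π * 15 ≤ 2 * π * Real.exp (14 + 8 / w₀) :=
    mul_le_mul_of_nonneg_left hexp15 (by positivity)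
  have ht10 : 10 ≤ t := by linarith
  have ht0 : 0 < t := by linarith
  -- `L = log (t/2π) ≥ 14 + 4/w₀`
  have hL : 14 + 8 / w₀ ≤ Real.log (t / (2 * π)) := by
    have h1 : Real.exp (14 + 8 / w₀) ≤ t / (2 * π) := by
      rw [le_div_iff₀ (by positivity)]; linarith
    calc 14 + 8 / w₀ = Real.log (Real.exp (14 + 8 / w₀)) := (Real.log_exp _).symm
      _ ≤ Real.log (t / (2 * π)) := Real.log_le_log (Real.exp_pos _) h1
  have hlogt : Real.log t = Real.log (t / (2 * π)) + Real.log (2 * π) := by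
    rw [Real.log_div ht0.ne' (by positivity)]; ring
  have hlog2π := log_two_pi_le_two
  have hlog2π0 : 0 ≤ Real.log (2 * π) := Real.log_nonneg (by linarith)
  -- the `θ'` floor `m` on `[t, ∞)`
  obtain ⟨m, hm⟩ : ∃ m : ℝ, m = Real.log (t / (2 * π)) / 2 - thetaDerivErr t := ⟨_, rfl⟩
  have herr : thetaDerivErr t ≤ 1 / 100 := thetaDerivErr_le_of_ten_le ht10
  have herr0 : 0 ≤ thetaDerivErr t := by unfold thetaDerivErr; positivity
  have hm_ge : Real.log (t / (2 * π)) / 2 - 1 / 100 ≤ m := by rw [hm]; linarith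
  have hm0 : 0 < m := by linarith
  -- `m · w₀ > π` (this is where the threshold `8/w₀` is used: `L/2 ≥ 7 + 4/w₀`)
  have hmw : π < m * w₀ := by
    have h48 : 2 * (4 / w₀) = 8 / w₀ := by ring
    have h1 : (7 + 4 / w₀ - 1 / 100) * w₀ ≤ m * w₀ :=
      mul_le_mul_of_nonneg_right (by linarith) hw₀.le
    have h2 : (7 + 4 / w₀ - 1 / 100) * w₀ = (7 - 1 / 100) * w₀ + 4 := by
      field_simp
      ring
    nlinarith
  -- the step `d` and the comparison point `t + d`
  have hgap0 : 0 < t' - t := by linarith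
  obtain ⟨d, hd⟩ : ∃ d : ℝ, d = min (2 * w₀) (9 / 10 * (t' - t)) := ⟨_, rfl⟩
  have hd0 : 0 < d := by rw [hd]; exact lt_min (by linarith) (by linarith)
  have hd2 : d ≤ 2 * w₀ := by rw [hd]; exact min_le_left _ _
  have hdlt : d < t' - t := by rw [hd]; exact (min_le_right _ _).trans_lt (by linarith)
  -- `N(t + d) = N(t)`, so `S(t) − S(t + d) = (θ(t + d) − θ(t))/π ≥ m d/π`
  have hN := count_eq_of_rhAbove_of_gap hRH hHt (u := t + d) (by linarith) (by linarith) hfree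
  have hS : zetaArgS t - zetaArgS (t + d) =
      (riemannSiegelTheta (t + d) - riemannSiegelTheta t) / π := by
    have := zetaArgS_sub t (t + d)
    rw [hN] at this
    linarith
  have hθ := theta_sub_ge (a := t) (b := t + d) (by linarith) (by linarith)
  rw [← hm, show t + d - t = d by ring] at hθ
  -- `m · d > 2π`
  have hmd : 2 * π < m * d := by
    rcases le_total (2 * w₀) (9 / 10 * (t' - t)) with hcase | hcase
    · have hdeq : d = 2 * w₀ := by rw [hd, min_eq_left hcase]
      rw [hdeq]
      linarith
    · have hdeq : d = 9 / 10 * (t' - t) := by rw [hd, min_eq_right hcase]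
      have hlogt0 : 0 < Real.log t := by rw [hlogt]; linarith
      -- `2π c' ≤ (t' − t) log t`
      have h1 : 2 * π * c' ≤ (t' - t) * Real.log t := by
        have := hc'le
        rw [le_div_iff₀ (by positivity)] at this
        linarith
      -- `log t < (9/10) m c'`
      have hmc : 3 * m < m * c' := by nlinarith
      have hc'0 : 0 < c' := by linarith
      have h2 : Real.log t < 9 / 10 * m * c' := by
        rw [hlogt]
        linarith [h4w.le]
      have h4 : (t' - t) * Real.log t < (t' - t) * (9 / 10 * m * c') :=
        mul_lt_mul_of_pos_left h2 hgap0
      have h5 : 2 * π * c' < m * (9 / 10 * (t' - t)) * c' := by linarith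
      rw [hdeq]
      exact lt_of_mul_lt_mul_right h5 hc'0.le
  -- conclusion: `S(t) − S(t + d) > 2` but the pin couples `t` and `t + d ≤ t + 2w₀`
  have hge : 2 < zetaArgS t - zetaArgS (t + d) := by
    rw [hS, lt_div_iff₀ Real.pi_pos]
    linarith
  have hlt := (abs_lt.1 (abs_sub_lt_of_dyadicPinW hB hHt (t₂ := t + d) (by linarith)
    (by linarith))).2
  linarith

/-- **N63 REFUTED**, for every height `H ≥ 0`, radius `1` and every constant width `w₀ > 0`,
riemannHypothesisUpTo_platt_trudgian-free: the pin supplies RH above `H` by itself (§2) and then the gap engine kills it. Modulo the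
unconditional named fact `buiMilinovich2018_theorem11_critical` only. -/
theorem not_dyadicPinW (hBM : buiMilinovich2018_theorem11_critical) {H w₀ : ℝ} (hH : 0 ≤ H)
    (hw₀ : 0 < w₀) : ¬ DyadicPinW H 1 fun _ ↦ w₀ := fun hB ↦
  not_dyadicPinW_of_rhAbove hBM hw₀
    (rhAbove_of_dyadicPinW hH le_rfl (fun _ _ _ _ _ ↦ le_rfl) (fun _ _ ↦ hw₀) hB) hB

/-- N63 proper, every height (a pin above a negative height is a pin above `0`). -/
theorem not_dyadicPin (hBM : buiMilinovich2018_theorem11_critical) (H : ℝ) : ¬ DyadicPin H := by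
  intro hB
  rcases le_total 0 H with hH | hH
  · exact not_dyadicPinW hBM hH one_pos hB
  · exact not_dyadicPinW hBM le_rfl one_pos (DyadicPinW.mono hH le_rfl hB)

/-- Every radius `r ≤ 1`, every constant width `w₀ > 0`, every height: REFUTED (mod BM2018). -/
theorem not_dyadicPinW_of_le_one (hBM : buiMilinovich2018_theorem11_critical) {H r w₀ : ℝ}
    (hr : r ≤ 1) (hw₀ : 0 < w₀) : ¬ DyadicPinW H r fun _ ↦ w₀ := by
  intro hB
  rcases le_total 0 H with hH | hH
  · exact not_dyadicPinW hBM hH hw₀ (hB.mono le_rfl hr)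
  · exact not_dyadicPinW hBM le_rfl hw₀ (hB.mono hH hr)

/-- The splitting `riemannHypothesisUpTo_platt_trudgian ∧ N63 → RH` is valid AND its tail is refuted (mod BM2018, unconditional). -/
theorem n63_summary (hBM : buiMilinovich2018_theorem11_critical) :
    (riemannHypothesisUpTo_platt_trudgian ∧ DyadicPin 3000175332800 → RiemannHypothesis) ∧ ¬ DyadicPin 3000175332800 :=
  ⟨fun h ↦ rh_of_fin_of_dyadicPin h.1 h.2, not_dyadicPin hBM 3000175332800⟩

end Summit.RiemannHypothesis.RiemannHypothesis.Theorems.Splittings.ZdReferencePins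

end
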